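import Summits.MatrixMultiplication.OmegaCensus.BoxKeyLift

/-!
# ω-census, family (b3): conjecture C9 (b) — a Klein four-group rotated by an element of any order gives box ratio `≥ 9/4`

HONEST FRAMING (pub-omega census; verbatim): lottery ticket; floor = certified bounds/negative ranges.
Census BOOKKEEPING (conjecture C9 of the cell, STRUCTURE.md §2; pub-omega kernel-l4 gen 16, task K-5 = the NON-nilpotent
side; first use of the key-lift lemma `BoxKeyLift`).

**Theorem (`KleinRot.not_boxUseful`).** Let `a, b, r ∈ G` with `a² = b² = 1`, `ab = ba`, `a ≠ 1`, `r a r⁻¹ = b`,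
`r b r⁻¹ = ab` — i.e. `r` permutes the three involutions of the Klein four-group `V = {1, a, b, ab}` cyclically; NOTHING is
assumed about the order of `r` (`r³` merely centralises `V`).  Then `G` is NOT box-useful: the box
`G × {1, r, r²} × {1, ar, ar²}` carries `(9/4)|G|` independent cells.  *Proof:* key-lift over `N = V` (`|N| = 4`) with the
ONE-CELL-PER-COLUMN pattern `n(y,w)`: `n = ab, b, b` on the row `y = 1`, `1, b, b` on `y = r`, `a, b, b` on `y = r²`
(columns `w = 1, ar, ar²`); all gauge words lie in `V` and the `72` key words are `a`, `b` or `ab` (one normal form: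
push `r^{±1}` to the right through `V`).  `9 = (9/4)·4` cells per key, so `5·9 ≥ 9·4`.  Found by machine (key-graph MIS in
`V ⋊ C₂₄`, seat script `keylift.py`; the value `9/4` is `A₄`'s census ratio `27/12`, here for every group containing the
configuration).
**Corollary (`not_boxUseful_of_rot3`).** An element `r` and an involution `v` with `v, rvr⁻¹, r²vr⁻²` pairwise commuting,
`r³ v r⁻³ = v` and `r v r⁻¹ ≠ v` (e.g. ANY element of `3`-power order acting non-trivially on a normal elementary abelian
`2`-subgroup) make `G` box-useless — the `A₄ = A(2,3)` atom of the non-nilpotent analysis in RELATION form, no homomorphism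
onto `A₄` needed (`SL(2,3)`, `C₂² ⋊ C₉`, `2^{2k} ⋊ C₃`, …).  Nothing here is progress on `ω`.
-/

namespace Summit.MatrixMultiplication.OmegaCensus

open Finset ProductBoxBound KeyLift

namespace KleinRot

variable {G : Type*} [Group G] {a b r : G}

/-- Column / row index type with three values. [folklore] -/
inductive Three where
  | i0 | i1 | i2
  deriving DecidableEq, Fintype

/-- The second box coordinate: `Y = {1, r, r²}`. [folklore] -/
def yv (r : G) : Three → G
  | .i0 => 1 | .i1 => r | .i2 => r * r

/-- The third box coordinate: `W = {1, ar, ar²}`. [folklore] -/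
def wv (a r : G) : Three → G
  | .i0 => 1 | .i1 => a * r | .i2 => a * r * r

/-- The one-cell-per-column key pattern `n(y,w) ∈ V`. [folklore] -/
def nv (a b : G) : Three → Three → G
  | .i0, .i0 => a * b | .i0, .i1 => b | .i0, .i2 => b
  | .i1, .i0 => 1 | .i1, .i1 => b | .i1, .i2 => b
  | .i2, .i0 => a | .i2, .i1 => b | .i2, .i2 => b

/-- The pattern triple `(n, y, w)` of a column index. [folklore] -/
def F (a b r : G) (ij : Three × Three) : G × G × G := (nv a b ij.1 ij.2, yv r ij.1, wv a r ij.2)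

section Rel

/-- `r (ab) r⁻¹ = a`. [folklore] -/
theorem conj_ab (hb2 : b * b = 1) (hab : a * b = b * a) (hra : r * a * r⁻¹ = b) (hrb : r * b * r⁻¹ = a * b) :
    r * (a * b) * r⁻¹ = a := by
  calc r * (a * b) * r⁻¹ = (r * a * r⁻¹) * (r * b * r⁻¹) := by group
    _ = b * (a * b) := by rw [hra, hrb]
    _ = a := by rw [hab, ← mul_assoc, hb2, one_mul]

/-- `r a = b r` (right-associated rewriting form). [folklore] -/
theorem R1 (hra : r * a * r⁻¹ = b) (t : G) : r * (a * t) = b * (r * t) := by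
  calc r * (a * t) = (r * a * r⁻¹) * (r * t) := by group
    _ = b * (r * t) := by rw [hra]
/-- `r a = b r`. [folklore] -/
theorem R1' (hra : r * a * r⁻¹ = b) : r * a = b * r := by simpa using R1 hra 1
/-- `r b = a b r`. [folklore] -/
theorem R2 (hrb : r * b * r⁻¹ = a * b) (t : G) : r * (b * t) = a * (b * (r * t)) := by
  calc r * (b * t) = (r * b * r⁻¹) * (r * t) := by group
    _ = a * (b * (r * t)) := by rw [hrb, mul_assoc]
/-- `r b = a b r`. [folklore] -/
theorem R2' (hrb : r * b * r⁻¹ = a * b) : r * b = a * (b * r) := by simpa using R2 hrb 1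
/-- `r⁻¹ a = a b r⁻¹`. [folklore] -/
theorem R3 (hb2 : b * b = 1) (hab : a * b = b * a) (hra : r * a * r⁻¹ = b) (hrb : r * b * r⁻¹ = a * b) (t : G) :
    r⁻¹ * (a * t) = a * (b * (r⁻¹ * t)) := by
  have e := conj_ab hb2 hab hra hrb
  calc r⁻¹ * (a * t) = r⁻¹ * a * t := by group
    _ = r⁻¹ * (r * (a * b) * r⁻¹) * t := by rw [e]
    _ = a * (b * (r⁻¹ * t)) := by group
/-- `r⁻¹ a = a b r⁻¹`. [folklore] -/
theorem R3' (hb2 : b * b = 1) (hab : a * b = b * a) (hra : r * a * r⁻¹ = b) (hrb : r * b * r⁻¹ = a * b) :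
    r⁻¹ * a = a * (b * r⁻¹) := by simpa using R3 hb2 hab hra hrb 1
/-- `r⁻¹ b = a r⁻¹`. [folklore] -/
theorem R4 (hra : r * a * r⁻¹ = b) (t : G) : r⁻¹ * (b * t) = a * (r⁻¹ * t) := by
  calc r⁻¹ * (b * t) = r⁻¹ * b * t := by group
    _ = r⁻¹ * (r * a * r⁻¹) * t := by rw [hra]
    _ = a * (r⁻¹ * t) := by group
/-- `r⁻¹ b = a r⁻¹`. [folklore] -/
theorem R4' (hra : r * a * r⁻¹ = b) : r⁻¹ * b = a * r⁻¹ := by simpa using R4 hra 1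
/-- `a a t = t`. [folklore] -/
theorem V1 (ha2 : a * a = 1) (t : G) : a * (a * t) = t := by rw [← mul_assoc, ha2, one_mul]
/-- `b b t = t`. [folklore] -/
theorem V2 (hb2 : b * b = 1) (t : G) : b * (b * t) = t := by rw [← mul_assoc, hb2, one_mul]
/-- `b a t = a b t`. [folklore] -/
theorem V3 (hab : a * b = b * a) (t : G) : b * (a * t) = a * (b * t) := by rw [← mul_assoc, ← hab, mul_assoc]
/-- `a⁻¹ = a`. [folklore] -/
theorem ainv (ha2 : a * a = 1) : a⁻¹ = a := inv_eq_of_mul_eq_one_right ha2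
/-- `b⁻¹ = b`. [folklore] -/
theorem binv (hb2 : b * b = 1) : b⁻¹ = b := inv_eq_of_mul_eq_one_right hb2

/-- `b ≠ 1`, `ab ≠ 1`, `r ≠ 1`, `r² ≠ 1` from `a ≠ 1`. [folklore] -/
theorem ne_facts (ha2 : a * a = 1) (hb2 : b * b = 1) (hab : a * b = b * a) (hra : r * a * r⁻¹ = b)
    (hrb : r * b * r⁻¹ = a * b) (ha1 : a ≠ 1) : b ≠ 1 ∧ a * b ≠ 1 ∧ r ≠ 1 ∧ r * r ≠ 1 := by
  refine ⟨?_, ?_, ?_, ?_⟩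
  · intro hb; apply ha1
    calc a = r⁻¹ * (r * a * r⁻¹) * r := by group
      _ = 1 := by rw [hra, hb]; group
  · intro h; apply ha1
    -- `ab = 1 ⇒ b = a ⇒ r b r⁻¹ = ab = 1 ⇒ b = 1 ⇒ a = 1`
    have hba : b = a := by
      calc b = a * (a * b) := (V1 ha2 b).symm
        _ = a := by rw [h, mul_one]
    have hb1 : b = 1 := by
      calc b = r⁻¹ * (r * b * r⁻¹) * r := by group
        _ = 1 := by rw [hrb, h]; group
    rw [← hba, hb1]
  · rintro rfl
    apply ha1
    have : a = b := by simpa using hra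
    -- `a = b ⇒ r b r⁻¹ = ab = 1`
    have h2 : a * b = 1 := by rw [this, hb2]
    have hb1 : b = 1 := by simpa [h2] using hrb
    rw [this, hb1]
  · intro h2
    apply ha1
    -- `r² = 1 ⇒ r = r⁻¹ ⇒ r⁻¹ a r = b`, but `r⁻¹ a r = ab` ⇒ `a = 1`
    have hr : r⁻¹ = r := inv_eq_of_mul_eq_one_right h2
    have e1 : r⁻¹ * a * r = a * b := by
      have := R3' hb2 hab hra hrb
      calc r⁻¹ * a * r = a * (b * r⁻¹) * r := by rw [this]
        _ = a * b := by group
    rw [hr] at e1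
    have e2 : r * a * r = b * (r * r) := by rw [R1' hra, mul_assoc]
    rw [h2, mul_one] at e2
    rw [e2] at e1
    -- `b = a b`
    calc a = a * b * b := by rw [mul_assoc, hb2, mul_one]
      _ = b * b := by rw [← e1]
      _ = 1 := hb2

/-- **A Klein four-group rotated by `r` makes `G` box-useless (ratio `≥ 9/4`).** [folklore] -/
theorem not_boxUseful [Fintype G] [DecidableEq G] (ha2 : a * a = 1) (hb2 : b * b = 1) (hab : a * b = b * a)
    (hra : r * a * r⁻¹ = b) (hrb : r * b * r⁻¹ = a * b) (ha1 : a ≠ 1) : ¬ BoxUseful G := by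
  classical
  obtain ⟨hb1, hab1, hr1, hrr1⟩ := ne_facts ha2 hb2 hab hra hrb ha1
  have ainv' := ainv ha2
  have binv' := binv hb2
  have hba : b * a = a * b := hab.symm
  have R1x := R1 (b := b) hra
  have R2x := R2 hrb
  have R3x := R3 hb2 hab hra hrb
  have R4x := R4 (b := b) hra
  have R1y := R1' (b := b) hra
  have R2y := R2' hrb
  have R3y := R3' hb2 hab hra hrb
  have R4y := R4' (b := b) hra
  have V1x := V1 ha2
  have V2x := V2 hb2
  have V3x := V3 hab
  -- more distinctness
  have har1 : a * r ≠ 1 := by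
    intro h
    have hr : r = a := by rw [eq_inv_of_mul_eq_one_right h, ainv']
    exact hrr1 (by rw [hr, ha2])
  have harr1 : a * r * r ≠ 1 := by
    intro h
    have e : r * r = a := by
      rw [mul_assoc] at h
      rw [eq_inv_of_mul_eq_one_right h, ainv']
    have e2 : r * r * a * (r * r)⁻¹ = a * b := by
      calc r * r * a * (r * r)⁻¹ = r * (r * a * r⁻¹) * r⁻¹ := by group
        _ = a * b := by rw [hra, hrb]
    rw [e] at e2
    have e3 : a = a * b := by simpa [ha2, ainv', mul_assoc] using e2
    exact hb1 (mul_left_cancel (e3.symm.trans (mul_one a).symm))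
  have harar : a * r ≠ a * r * r := by
    intro h
    exact hr1 (mul_left_cancel (h.symm.trans (mul_one (a * r)).symm))
  -- the subgroup `N = V = {1, a, b, ab}`
  let S : Finset G := {1, a, b, a * b}
  have memS : ∀ x, x ∈ S ↔ x = 1 ∨ x = a ∨ x = b ∨ x = a * b := fun x => by
    simp only [S, Finset.mem_insert, Finset.mem_singleton]
  have hS1 : (1 : G) ∈ S := (memS 1).2 (Or.inl rfl)
  have hSmul : ∀ x ∈ S, ∀ y ∈ S, x * y ∈ S := by
    intro x hx y hy
    rw [memS] at hx hy ⊢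
    rcases hx with rfl | rfl | rfl | rfl <;> rcases hy with rfl | rfl | rfl | rfl <;>
      simp [mul_assoc, ha2, hb2, V1x, V3x, hba]
  have hSinv : ∀ x ∈ S, x⁻¹ ∈ S := by
    intro x hx
    rw [memS] at hx ⊢
    rcases hx with rfl | rfl | rfl | rfl <;> simp [mul_inv_rev, ainv', binv', hba]
  let N : Subgroup G := subgroupOfFinset S hS1 hSmul hSinv
  have memN : ∀ x, x ∈ N ↔ x = 1 ∨ x = a ∨ x = b ∨ x = a * b := fun x => by
    rw [← memS]; exact mem_subgroupOfFinset
  have cardN : Nat.card N ≤ 4 := by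
    rw [card_subgroupOfFinset]
    exact (Finset.card_insert_le _ _).trans (Nat.succ_le_succ ((Finset.card_insert_le _ _).trans
      (Nat.succ_le_succ ((Finset.card_insert_le _ _).trans (Nat.succ_le_succ (Finset.card_singleton _).le)))))
  -- the box
  have yv_inj : Function.Injective (yv r) := by
    intro i j h
    cases i <;> cases j <;> simp only [yv] at h
    all_goals first | rfl | exfalso
    all_goals first | exact hr1 h | exact hr1 h.symm | exact hrr1 h | exact hrr1 h.symm | exact hr1 (mul_left_cancel (h.trans (mul_one r).symm)) | exact hr1 (mul_left_cancel (h.symm.trans (mul_one r).symm))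
  have wv_inj : Function.Injective (wv a r) := by
    intro i j h
    cases i <;> cases j <;> simp only [wv] at h
    all_goals first | rfl | exfalso
    all_goals first | exact har1 h | exact har1 h.symm | exact harr1 h | exact harr1 h.symm | exact harar h | exact harar h.symm
  have card3 : (Finset.univ : Finset Three).card = 3 := rfl
  set Y : Finset G := Finset.univ.image (yv r) with hY
  set W : Finset G := Finset.univ.image (wv a r) with hW
  have cY : #Y = 3 := by rw [hY, Finset.card_image_of_injective _ yv_inj, card3]
  have cW : #W = 3 := by rw [hW, Finset.card_image_of_injective _ wv_inj, card3]
  have F_inj : Function.Injective (F a b r) := by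
    rintro ⟨i, j⟩ ⟨i', j'⟩ h
    simp only [F, Prod.mk.injEq] at h
    obtain ⟨-, h2, h3⟩ := h
    rw [yv_inj h2, wv_inj h3]
  set T : Finset (G × G × G) := Finset.univ.image (F a b r) with hTdef
  have card9 : (Finset.univ : Finset (Three × Three)).card = 9 := rfl
  have cT : #T = 9 := by rw [hTdef, Finset.card_image_of_injective _ F_inj, card9]
  refine KeyLift.not_boxUseful N cY cW (T := T) ?_ ?_ ?_ ?_ (by rw [cT]; omega)
  · -- `T ⊆ univ × (Y × W)`
    intro t ht
    obtain ⟨⟨i, j⟩, -, rfl⟩ := Finset.mem_image.1 ht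
    simp only [F, Finset.mem_product, Finset.mem_univ, true_and, hY, hW]
    exact ⟨Finset.mem_image_of_mem _ (Finset.mem_univ _), Finset.mem_image_of_mem _ (Finset.mem_univ _)⟩
  · -- pattern elements lie in `N`
    intro t ht
    obtain ⟨⟨i, j⟩, -, rfl⟩ := Finset.mem_image.1 ht
    rw [memN]
    cases i <;> cases j <;> simp [F, nv]
  · -- gauge words lie in `N`
    intro t ht t' ht'
    obtain ⟨⟨i, j⟩, -, rfl⟩ := Finset.mem_image.1 ht
    obtain ⟨⟨i', j'⟩, -, rfl⟩ := Finset.mem_image.1 ht'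
    rw [memN]
    cases i <;> cases j <;> cases i' <;> cases j' <;>
      simp only [F, yv, wv, gaugeWord, mul_assoc, mul_inv_rev, inv_one, one_mul, mul_one, ainv', binv',
        R1x, R2x, R3x, R4x, R1y, R2y, R3y, R4y, V1x, V2x, V3x, ha2, hb2, hba, mul_inv_cancel_left,
        mul_inv_cancel, true_or, or_true]
  · -- key words are never trivial
    intro t ht t' ht' hne
    obtain ⟨⟨i, j⟩, -, rfl⟩ := Finset.mem_image.1 ht
    obtain ⟨⟨i', j'⟩, -, rfl⟩ := Finset.mem_image.1 ht'
    cases i <;> cases j <;> cases i' <;> cases j'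
    all_goals first | exact absurd rfl hne | skip
    all_goals
      simp only [F, nv, yv, wv, cellWord, baseCell, mul_assoc, mul_inv_rev, inv_inv, inv_one, one_mul, mul_one, ainv',
        binv', R1x, R2x, R3x, R4x, R1y, R2y, R3y, R4y, V1x, V2x, V3x, ha2, hb2, hba, mul_inv_cancel_left,
        inv_mul_cancel_left, mul_inv_cancel, inv_mul_cancel, ne_eq, ha1, hb1, hab1, not_false_eq_true]

end Rel

section

/-- **Rotation form.** An involution `v` and an element `r` such that `v`, `v₁ = r v r⁻¹`, `v₂ = r v₁ r⁻¹` pairwise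
commute, `r v₂ r⁻¹ = v` and `v₁ ≠ v` make `G` box-useless (take `a = v v₁`, `b = v₁ v₂`).  This is the shape in which
the configuration arises: an element of `3`-power order acting non-trivially on an elementary abelian normal
`2`-subgroup. [folklore] -/
theorem not_boxUseful_of_rot3 [Fintype G] [DecidableEq G] {v r : G} (hv2 : v * v = 1)
    (hc01 : v * (r * v * r⁻¹) = (r * v * r⁻¹) * v)
    (hc02 : v * (r * r * v * r⁻¹ * r⁻¹) = (r * r * v * r⁻¹ * r⁻¹) * v)
    (hc12 : (r * v * r⁻¹) * (r * r * v * r⁻¹ * r⁻¹) = (r * r * v * r⁻¹ * r⁻¹) * (r * v * r⁻¹))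
    (h3 : r * r * r * v * r⁻¹ * r⁻¹ * r⁻¹ = v) (hne : r * v * r⁻¹ ≠ v) : ¬ BoxUseful G := by
  set v₁ := r * v * r⁻¹ with hv₁
  set v₂ := r * r * v * r⁻¹ * r⁻¹ with hv₂
  have hv₁2 : v₁ * v₁ = 1 := by rw [hv₁]; calc _ = r * (v * v) * r⁻¹ := by group
    _ = 1 := by rw [hv2]; group
  have hv₂2 : v₂ * v₂ = 1 := by rw [hv₂]; calc _ = r * r * (v * v) * r⁻¹ * r⁻¹ := by group
    _ = 1 := by rw [hv2]; group
  have hr1 : r * v₁ * r⁻¹ = v₂ := by rw [hv₁, hv₂]; group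
  have hr2 : r * v₂ * r⁻¹ = v := by
    rw [hv₂]
    calc r * (r * r * v * r⁻¹ * r⁻¹) * r⁻¹ = r * r * r * v * r⁻¹ * r⁻¹ * r⁻¹ := by group
      _ = v := h3
  refine not_boxUseful (a := v * v₁) (b := v₁ * v₂) (r := r) ?_ ?_ ?_ ?_ ?_ ?_
  · calc v * v₁ * (v * v₁) = v * (v₁ * v) * v₁ := by group
      _ = v * (v * v₁) * v₁ := by rw [hc01]
      _ = (v * v) * (v₁ * v₁) := by group
      _ = 1 := by rw [hv2, hv₁2, one_mul]
  · calc v₁ * v₂ * (v₁ * v₂) = v₁ * (v₂ * v₁) * v₂ := by group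
      _ = v₁ * (v₁ * v₂) * v₂ := by rw [hc12]
      _ = (v₁ * v₁) * (v₂ * v₂) := by group
      _ = 1 := by rw [hv₁2, hv₂2, one_mul]
  · -- `(v v₁)(v₁ v₂) = (v₁ v₂)(v v₁)`
    calc v * v₁ * (v₁ * v₂) = v * (v₁ * v₁) * v₂ := by group
      _ = v * v₂ := by rw [hv₁2, mul_one]
      _ = v₂ * v := hc02
      _ = v₂ * (v₁ * v₁) * v := by rw [hv₁2, mul_one]
      _ = (v₂ * v₁) * (v₁ * v) := by group
      _ = (v₁ * v₂) * (v * v₁) := by rw [hc12, hc01]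
  · calc r * (v * v₁) * r⁻¹ = (r * v * r⁻¹) * (r * v₁ * r⁻¹) := by group
      _ = v₁ * v₂ := by rw [hr1]
  · calc r * (v₁ * v₂) * r⁻¹ = (r * v₁ * r⁻¹) * (r * v₂ * r⁻¹) := by group
      _ = v₂ * v := by rw [hr1, hr2]
      _ = v * v₂ := hc02.symm
      _ = v * (v₁ * v₁) * v₂ := by rw [hv₁2, mul_one]
      _ = v * v₁ * (v₁ * v₂) := by group
  · intro h
    apply hne
    -- `v v₁ = 1 ⇒ v₁ = v⁻¹ = v`
    calc v₁ = v⁻¹ := (eq_inv_of_mul_eq_one_right h)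
      _ = v := inv_eq_of_mul_eq_one_right hv2

end

end KleinRot

end Summit.MatrixMultiplication.OmegaCensus
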